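import Summits.HodgeConjecture.HodgeCM.PerL34.FockInvariantLines_1

/-! PORT of `HodgeCM/PerL34/FockInvariantLines.lean` (HodgeCMPerL run 82) — part 2: continuation of `Summits.HodgeConjecture.HodgeCM.PerL34.FockInvariantLines_1` (split at a top-level declaration boundary by port_pkg.py; scope re-opened below; declarations unchanged). -/

-- port_pkg: scope re-opened for this part (file-level context, then the namespace/section stack open at the cut)
set_option autoImplicit false
noncomputable section
open MeasureTheory Complex MvPolynomial Matrix
open scoped Real ComplexConjugate InnerProductSpace
namespace HodgeCM.PerL34.Fock.Hermite
variable {σ : Type*} [Fintype σ] [DecidableEq σ]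
section Mix
variable {τ : Type*} [DecidableEq τ] (i j : τ)
variable {i j}
/-- The rows are orthonormal: `row_k · row_l = δ_{kl}`. -/
theorem mixRow_dotProduct [Fintype τ] (hij : i ≠ j) (k l : τ) :
    mixRow i j k ⬝ᵥ mixRow i j l = if k = l then 1 else 0 := by
  by_cases hki : k = i
  · rw [hki, mixRow_i, add_dotProduct, smul_dotProduct, smul_dotProduct, single_dotProduct,
      single_dotProduct, one_mul, one_mul, smul_eq_mul, smul_eq_mul, mixRow_apply_i hij, mixRow_apply_j hij]
    by_cases hli : l = i
    · rw [if_pos hli, if_pos hli, if_pos hli.symm]; norm_num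
    · rw [if_neg hli, if_neg hli, if_neg (Ne.symm hli)]
      by_cases hlj : l = j
      · rw [if_pos hlj, if_pos hlj]; norm_num
      · rw [if_neg hlj, if_neg hlj]; norm_num
  · by_cases hkj : k = j
    · rw [hkj, mixRow_j hij, sub_dotProduct, smul_dotProduct, smul_dotProduct, single_dotProduct,
        single_dotProduct, one_mul, one_mul, smul_eq_mul, smul_eq_mul, mixRow_apply_i hij, mixRow_apply_j hij]
      by_cases hli : l = i
      · rw [if_pos hli, if_pos hli, if_neg (by rw [hli]; exact Ne.symm hij)]; norm_num
      · rw [if_neg hli, if_neg hli]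
        by_cases hlj : l = j
        · rw [if_pos hlj, if_pos hlj, if_pos hlj.symm]; norm_num
        · rw [if_neg hlj, if_neg hlj, if_neg (Ne.symm hlj)]; norm_num
    · rw [mixRow_other hki hkj, single_dotProduct, one_mul, mixRow_apply_other hij hki hkj]
      by_cases hlk : l = k
      · rw [if_pos hlk, if_pos hlk.symm]
      · rw [if_neg hlk, if_neg (Ne.symm hlk)]

/-- (Ported verbatim from the HodgeCMPerL package; no docstring in the source.) -/
theorem mixM_apply (k m : τ) : mixM i j k m = mixRow i j k m := rfl

/-- `mixM i j` is unitary (`i ≠ j`). -/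
theorem mixM_mem_unitaryGroup [Fintype τ] (hij : i ≠ j) : mixM i j ∈ Matrix.unitaryGroup τ ℂ := by
  rw [Matrix.mem_unitaryGroup_iff]
  ext k l
  rw [Matrix.mul_apply', Matrix.one_apply]
  have hcol : (fun m => (star (mixM i j)) m l) = mixRow i j l := by
    funext m
    rw [Matrix.star_apply, mixM_apply, star_mixRow_apply hij]
  rw [hcol]
  exact mixRow_dotProduct hij k l

/-- **The mixing unitary** `mixU i j ∈ U(τ)` (`i ≠ j`). -/
def mixU [Fintype τ] (hij : i ≠ j) : Matrix.unitaryGroup τ ℂ := ⟨mixM i j, mixM_mem_unitaryGroup hij⟩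

/-- (Ported verbatim from the HodgeCMPerL package; no docstring in the source.) -/
@[simp] theorem coe_mixU [Fintype τ] (hij : i ≠ j) :
    ((mixU hij : Matrix.unitaryGroup τ ℂ) : Matrix τ τ ℂ) = mixM i j := rfl

/-- (Ported verbatim from the HodgeCMPerL package; no docstring in the source.) -/
theorem coe_star_mixU [Fintype τ] (hij : i ≠ j) :
    ((star (mixU hij) : Matrix.unitaryGroup τ ℂ) : Matrix τ τ ℂ) = star (mixM i j) := rfl

/-- (Ported verbatim from the HodgeCMPerL package; no docstring in the source.) -/
theorem probePt_self : probePt i i = 0 := by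
  unfold probePt
  rw [Function.update_self]

/-- (Ported verbatim from the HodgeCMPerL package; no docstring in the source.) -/
theorem probePt_of_ne {k : τ} (hk : k ≠ i) : probePt i k = 1 := by
  unfold probePt
  rw [Function.update_of_ne hk]

/-- `mixM p^{(i)}` has NO zero coordinate: it is `4/5` at `i`, `−3/5` at `j`, `1` elsewhere. -/
theorem mixM_mulVec_probePt [Fintype τ] (hij : i ≠ j) (k : τ) :
    (mixM i j *ᵥ probePt i) k = if k = i then 4 / 5 else if k = j then -(3 / 5) else 1 := by
  change mixRow i j k ⬝ᵥ probePt i = _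
  by_cases hki : k = i
  · rw [hki, mixRow_i, add_dotProduct, smul_dotProduct, smul_dotProduct, single_dotProduct, single_dotProduct,
      probePt_self, probePt_of_ne (Ne.symm hij), if_pos rfl, mul_zero, smul_zero, zero_add, one_mul, smul_eq_mul,
      mul_one]
  · rw [if_neg hki]
    by_cases hkj : k = j
    · rw [hkj, mixRow_j hij, sub_dotProduct, smul_dotProduct, smul_dotProduct, single_dotProduct,
        single_dotProduct, probePt_self, probePt_of_ne (Ne.symm hij), if_pos rfl, mul_zero, smul_zero, zero_sub,
        one_mul, smul_eq_mul, mul_one]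
    · rw [if_neg hkj, mixRow_other hki hkj, single_dotProduct, probePt_of_ne hki, one_mul]

/-- (Ported verbatim from the HodgeCMPerL package; no docstring in the source.) -/
theorem mixM_mulVec_probePt_ne_zero [Fintype τ] (hij : i ≠ j) (k : τ) : (mixM i j *ᵥ probePt i) k ≠ 0 := by
  rw [mixM_mulVec_probePt hij]
  split_ifs <;> norm_num

end Mix

omit [DecidableEq σ] in
/-- `z^α` vanishes at a point with `z_i = 0` if `α_i ≠ 0`. -/
theorem eval_zeta_eq_zero_of_apply_eq_zero {z : σ → ℂ} {i : σ} (hz : z i = 0) {α : σ →₀ ℕ}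
    (hα : α i ≠ 0) : eval z (zeta α) = 0 := by
  classical
  rw [zeta, smul_eval, eval_monomial, one_mul, Finsupp.prod,
    Finset.prod_eq_zero (Finsupp.mem_support_iff.mpr hα) (by rw [hz, zero_pow hα]), mul_zero]

omit [DecidableEq σ] in
/-- `z^α ≠ 0` at a point with no zero coordinate. -/
theorem eval_zeta_ne_zero_of_forall_ne_zero {z : σ → ℂ} (hz : ∀ l, z l ≠ 0) (α : σ →₀ ℕ) :
    eval z (zeta α) ≠ 0 := by
  classical
  rw [zeta, smul_eval, eval_monomial, one_mul]
  refine mul_ne_zero (by exact_mod_cast (hcoef_pos α).ne') ?_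
  rw [Finsupp.prod]
  exact Finset.prod_ne_zero_iff.mpr fun l _ => pow_ne_zero _ (hz l)

/-- **The line `ℂ·ζ_α`, `α ≠ 0`, is moved by `(mixU i j)⁻¹ = (mixU i j)†`** (`α_i ≠ 0`, `j ≠ i`):
`ν₀(mixU†) ζ_α ∉ ℂ·ζ_α`.  Proof: `ν₀(mixU†) ζ_α = μ ζ_α` would give the polynomial identity
`ζ_α(mixM z) = μ ζ_α(z)` (`fockToL2_injective`); at `z = p^{(i)}` the right side vanishes and the left does not. -/
theorem fockBasis_line_not_mixStable {i j : σ} (hij : i ≠ j) {α : σ →₀ ℕ} (hα : α i ≠ 0) :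
    fockRep (star (mixU hij)) (fockBasis α : FockL2 σ) ∉ ℂ ∙ (fockBasis α : FockL2 σ) := by
  intro hmem
  obtain ⟨μ, hμ⟩ := Submodule.mem_span_singleton.mp hmem
  rw [fockBasis_apply, ← fockToL2_zeta, fockRep_fockToL2, ← map_smul] at hμ
  have hpoly : μ • zeta α = linSubst (star (star (mixM i j))) (zeta α) := fockToL2_injective hμ
  rw [star_star] at hpoly
  have heval := congrArg (eval (probePt i)) hpoly
  rw [smul_eval, eval_linSubst, eval_zeta_eq_zero_of_apply_eq_zero (probePt_self (i := i)) hα,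
    mul_zero] at heval
  exact eval_zeta_ne_zero_of_forall_ne_zero (mixM_mulVec_probePt_ne_zero hij) α heval.symm

/-! ## §5  [Fo89 p. 182 L39–40] on `𝓕_σ`: `|σ| > 1` — the vacuum line only; `|σ| = 1` — the lines `𝓟ₖ` -/

/-- **Folland p. 182 L39–40, `n > 1`, on the `L²` Fock space.**  If `σ` has at least two elements, a non-zero
vector `v ∈ 𝓕_σ` spans a `U(σ)`-stable line iff it is a multiple of the vacuum `ζ₀`:
"the only one-dimensional U(n)-invariant subspaces of $\mathcal{F}_n$ are … the single space $\mathcal{P}_0$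
when n > 1". -/
theorem unitaryStable_line_iff [Nontrivial σ] {v : FockL2 σ} (hv : v ≠ 0) :
    (∀ U : Matrix.unitaryGroup σ ℂ, fockRep U v ∈ ℂ ∙ v) ↔ v ∈ ℂ ∙ (fockBasis 0 : FockL2 σ) := by
  constructor
  · intro h
    obtain ⟨α, a, ha, rfl⟩ :=
      exists_eq_smul_fockBasis_of_torusStable_line hv fun t => h (diagHom t)
    by_cases hα0 : α = 0
    · subst hα0
      exact Submodule.mem_span_singleton.mpr ⟨a, rfl⟩
    · exfalso
      obtain ⟨i, hi⟩ := Finsupp.ne_iff.mp hα0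
      obtain ⟨j, hji⟩ := exists_ne i
      have hαi : α i ≠ 0 := by simpa using hi
      apply fockBasis_line_not_mixStable (Ne.symm hji) hαi
      have hmem := h (star (mixU (Ne.symm hji)))
      rw [map_smul] at hmem
      have hmem' : a⁻¹ • (a • fockRep (star (mixU (Ne.symm hji))) (fockBasis α : FockL2 σ)) ∈
          ℂ ∙ (a • (fockBasis α : FockL2 σ)) := Submodule.smul_mem _ _ hmem
      rw [smul_smul, inv_mul_cancel₀ ha, one_smul] at hmem'
      obtain ⟨μ, hμ⟩ := Submodule.mem_span_singleton.mp hmem'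
      rw [smul_smul] at hμ
      exact Submodule.mem_span_singleton.mpr ⟨μ * a, hμ⟩
  · intro hmem U
    obtain ⟨a, rfl⟩ := Submodule.mem_span_singleton.mp hmem
    rw [map_smul, fockRep_fockBasis_zero]
    exact Submodule.mem_span_singleton_self _

omit [DecidableEq σ] in
/-- In dimension one every multi-index is `k·e`: `𝓟ₖ = ℂ·ζ_{k e}`. -/
theorem degSpan_singleton_eq_span_of_subsingleton [Subsingleton σ] (l : σ) (k : ℕ) :
    degSpan (σ := σ) ({k} : Set ℕ) = ℂ ∙ (fockBasis (Finsupp.single l k) : FockL2 σ) := by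
  rw [degSpan]
  congr 1
  ext x
  constructor
  · rintro ⟨α, hα, rfl⟩
    have hαeq : α = Finsupp.single l k := by
      ext m
      have hml : m = l := Subsingleton.elim m l
      subst hml
      rw [Finsupp.single_eq_same]
      have hk : mdeg α = k := hα
      rw [← hk]
      unfold mdeg
      rw [Finset.sum_eq_single_of_mem m (Finset.mem_univ m) (fun b _ hb => absurd (Subsingleton.elim b m) hb)]
    rw [hαeq]
    exact Set.mem_singleton _
  · intro hx
    rw [Set.mem_singleton_iff] at hx
    subst hx
    refine ⟨Finsupp.single l k, ?_, rfl⟩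
    change mdeg (Finsupp.single l k) = k
    unfold mdeg
    rw [Finset.sum_eq_single_of_mem l (Finset.mem_univ l) (fun b _ hb => absurd (Subsingleton.elim b l) hb),
      Finsupp.single_eq_same]

/-- In dimension one every unitary is central: `U = u·1`, `u = U_{ll} ∈ S¹`. -/
theorem eq_scalarU_of_subsingleton [Subsingleton σ] (l : σ) (U : Matrix.unitaryGroup σ ℂ) :
    ∃ c : Circle, U = scalarU c := by
  have hU := Matrix.mem_unitaryGroup_iff.mp U.2
  have hll : ((U : Matrix σ σ ℂ) * star (U : Matrix σ σ ℂ)) l l = (1 : Matrix σ σ ℂ) l l := by rw [hU]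
  rw [Matrix.mul_apply, Finset.sum_eq_single_of_mem l (Finset.mem_univ l)
    (fun b _ hb => absurd (Subsingleton.elim b l) hb), Matrix.star_apply, Matrix.one_apply_eq,
    Complex.star_def, Complex.mul_conj, ← Complex.ofReal_one, Complex.ofReal_inj,
    Complex.normSq_eq_norm_sq, pow_eq_one_iff_of_nonneg (norm_nonneg _) two_ne_zero] at hll
  refine ⟨⟨(U : Matrix σ σ ℂ) l l, mem_sphere_zero_iff_norm.2 hll⟩, ?_⟩
  apply Subtype.ext
  rw [coe_scalarU]
  ext a b
  rw [Subsingleton.elim a l, Subsingleton.elim b l, Matrix.smul_apply, Matrix.one_apply_eq, smul_eq_mul,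
    mul_one]

/-- **Folland p. 182 L39–40, `n = 1`, on the `L²` Fock space**: when `|σ| = 1`, a non-zero `v` spans a
`U(σ)`-stable line iff `v ∈ 𝓟ₖ = ℂ·ζ_k` for some `k` ("the spaces $\mathcal{P}_k$ when n = 1"). -/
theorem unitaryStable_line_iff_of_subsingleton [Subsingleton σ] (l : σ) {v : FockL2 σ} (hv : v ≠ 0) :
    (∀ U : Matrix.unitaryGroup σ ℂ, fockRep U v ∈ ℂ ∙ v) ↔ ∃ k : ℕ, v ∈ degSpan ({k} : Set ℕ) := by
  constructor
  · intro h
    exact exists_mem_degSpan_of_centreStable_line hv fun c => h (scalarU c)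
  · rintro ⟨k, hk⟩ U
    obtain ⟨c, rfl⟩ := eq_scalarU_of_subsingleton l U
    have h1 : fockRep (scalarU c) v = ((conj (c : ℂ)) ^ k) • v := circleRep_of_mem_degSpan_singleton hk c
    rw [h1]
    exact Submodule.smul_mem _ _ (Submodule.mem_span_singleton_self v)

/-! ## §6  Proposition (4.76) on `L²(ℝ^σ)` for the transported operators `schrodingerU = B⁻¹ ν₀ B` -/

/-- Transport of stable lines through the Bargmann unitary. -/
theorem schrodingerStable_iff_bargmann (f : Lp ℂ 2 (volume : Measure (σ → ℝ))) :
    (∀ U : Matrix.unitaryGroup σ ℂ, schrodingerU U f ∈ ℂ ∙ f) ↔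
      ∀ U : Matrix.unitaryGroup σ ℂ, fockRep U (bargmann f) ∈ ℂ ∙ bargmann f := by
  constructor
  · intro h U
    obtain ⟨μ, hμ⟩ := Submodule.mem_span_singleton.mp (h U)
    rw [schrodingerU_apply] at hμ
    have h1 := congrArg bargmann hμ
    rw [LinearIsometryEquiv.map_smul, LinearIsometryEquiv.apply_symm_apply] at h1
    exact Submodule.mem_span_singleton.mpr ⟨μ, h1⟩
  · intro h U
    obtain ⟨μ, hμ⟩ := Submodule.mem_span_singleton.mp (h U)
    refine Submodule.mem_span_singleton.mpr ⟨μ, ?_⟩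
    rw [schrodingerU_apply, ← hμ, LinearIsometryEquiv.map_smul, LinearIsometryEquiv.symm_apply_apply]

/-- **[Fo89 (4.76) Proposition], `n > 1`, for the operators `B⁻¹ ν₀(U) B`, `U ∈ U(σ)`** (= `μ(𝒜)`, `𝒜 ∈ K`,
up to the scalar `det^{-1/2}`, which moves no line): "The only one-dimensional subspaces of $L^2(\mathbf{R}^n)$
that are invariant under the operators $\mu(\mathcal{A})$ for all $\mathcal{A} \in K$ are … the span of
$\gamma(x) = e^{-\pi x^2}$ when n > 1" — here `ℂ·h₀`, `h₀ = hermiteL2 0` the normalised Gaussian. -/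
theorem schrodingerStable_line_iff [Nontrivial σ] {f : Lp ℂ 2 (volume : Measure (σ → ℝ))} (hf : f ≠ 0) :
    (∀ U : Matrix.unitaryGroup σ ℂ, schrodingerU U f ∈ ℂ ∙ f) ↔ f ∈ ℂ ∙ hermiteL2 (0 : σ →₀ ℕ) := by
  have hbf : bargmann f ≠ 0 := fun h0 => hf ((LinearIsometryEquiv.map_eq_zero_iff _).mp h0)
  rw [schrodingerStable_iff_bargmann, unitaryStable_line_iff hbf, Submodule.mem_span_singleton,
    Submodule.mem_span_singleton]
  constructor
  · rintro ⟨a, ha⟩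
    refine ⟨a, ?_⟩
    have h1 := congrArg bargmann.symm ha
    rw [LinearIsometryEquiv.symm_apply_apply, LinearIsometryEquiv.map_smul, fockBasis_apply,
      bargmann_symm_fockVec] at h1
    exact h1
  · rintro ⟨a, rfl⟩
    exact ⟨a, by rw [LinearIsometryEquiv.map_smul, bargmann_hermiteL2, fockBasis_apply]⟩

/-- **[Fo89 (4.76) Proposition], `n = 1`**: "… are the spans of the Hermite functions $h_j$
$(0 \le j \le \infty)$ when n = 1" — for `|σ| = 1`, a non-zero `f ∈ L²(ℝ^σ)` spans a line stable under all
`B⁻¹ ν₀(U) B` iff `f ∈ ℂ·h_k` for some `k`. -/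
theorem schrodingerStable_line_iff_of_subsingleton [Subsingleton σ] (l : σ)
    {f : Lp ℂ 2 (volume : Measure (σ → ℝ))} (hf : f ≠ 0) :
    (∀ U : Matrix.unitaryGroup σ ℂ, schrodingerU U f ∈ ℂ ∙ f) ↔
      ∃ k : ℕ, f ∈ ℂ ∙ hermiteL2 (Finsupp.single l k) := by
  have hbf : bargmann f ≠ 0 := fun h0 => hf ((LinearIsometryEquiv.map_eq_zero_iff _).mp h0)
  rw [schrodingerStable_iff_bargmann, unitaryStable_line_iff_of_subsingleton l hbf]
  refine exists_congr fun k => ?_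
  rw [degSpan_singleton_eq_span_of_subsingleton l k, Submodule.mem_span_singleton,
    Submodule.mem_span_singleton]
  constructor
  · rintro ⟨a, ha⟩
    refine ⟨a, ?_⟩
    have h1 := congrArg bargmann.symm ha
    rw [LinearIsometryEquiv.symm_apply_apply, LinearIsometryEquiv.map_smul, fockBasis_apply,
      bargmann_symm_fockVec] at h1
    exact h1
  · rintro ⟨a, rfl⟩
    exact ⟨a, by rw [LinearIsometryEquiv.map_smul, bargmann_hermiteL2, fockBasis_apply]⟩

end HodgeCM.PerL34.Fock.Hermite

end
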